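import Literature.AlgebraicGeometry.HodgeTheory.SpreadingOutQbarFamilyProofs
import HarnessLib

/-!
# A smooth projective variety in characteristic zero has a smooth projective model over a finitely generated subring

Topic `Literature/AlgebraicGeometry/Limits` (EGA IV₃ §8, "spreading out"). The arithmetic variant
of the tree's `HodgeTheory.SpreadingOutQbar.exists_smooth_projective_spread` (there: over a smooth
variety over a perfect ground FIELD `k`), with the ground field replaced by `ℤ`: for `X` a smooth
projective variety of dimension `n` over a field `K` of characteristic zero there are a finitely
generated subring `T ⊆ K` (an integral domain of finite type over `ℤ`, through an injective
`ψ : T → K`), a closed subscheme `Y ↪ ℙᴺ_T` whose structure morphism `g : Y → Spec T` is proper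
and smooth of relative dimension `n`, and a cartesian square exhibiting `X → Spec K` as the base
change of `g` along `Spec ψ` (`exists_smooth_projective_model_finiteType_int`). This is the
standard first step of every "reduction modulo `p`" argument for complex varieties (Serre, *How to
use finite fields for problems concerning infinite fields*, §1; EGA IV₃ 8.8.2, 8.10.5, IV₄ 17.7.8;
Maulik–Poonen 2012, §4, "spreading out").

Proof (the tree's `exists_smooth_projective_spread`, with the polynomial ring `k[t₀]` replaced by
`ℤ[t₀]`): `X` is integral and `X ↪ ℙᴺ_K` descends to an integral `E ↪ ℙᴺ_{K₀}`, `K₀ = ℚ(t₀)`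
(`Limits.exists_isPullback_specMap_of_isProjectiveOver`); `E/K₀` is smooth (fpqc descent) of
relative dimension `n`; `R = ℤ[t₀] ⊆ K` has fraction field `K₀` (`isFractionRing_adjoin_int`); the
scheme-theoretic closure of `E` in `ℙᴺ_R` is an irreducible projective model
(`SpreadingOutQbar.exists_irreducible_projectiveModel`); its smooth locus contains the generic
fibre, so it is smooth over `T = R[1/s]` (`Limits.LocApprox.exists_forall_smooth_snd`); the relative
dimension is constant (`= n`) on the irreducible total space.

Geometric irreducibility of the fibres is NOT asserted here (over the non-normal base `Spec T` the
tree's Zariski-connectedness argument does not apply directly); consumers recover it over normal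
bases (e.g. `W(κ)`) from the generic fibre.

## References

* [EGAIV3] A. Grothendieck, J. Dieudonné, EGA IV₃, Thm. 8.8.2 (ii), Thm. 8.10.5.
* [EGAIV4] EGA IV₄, Prop. 17.7.8.
* [MaulikPoonen2012] D. Maulik, B. Poonen, Néron–Severi groups under specialization, Duke Math.
  J. 161 (2012), §4 (spreading out to a finitely generated ℤ-algebra).
-/

noncomputable section

universe u

open CategoryTheory CategoryTheory.Limits AlgebraicGeometry TopologicalSpace MvPolynomial
open Literature.AlgebraicGeometry.Motives
open Literature.AlgebraicGeometry.HodgeTheory.SpreadingOutQbar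
open scoped IntermediateField.algebraAdjoinAdjoin

namespace Literature.AlgebraicGeometry.Limits

/-! ## `Frac ℤ[t₀] = ℚ(t₀)` inside a field of characteristic zero -/

section FractionField

variable {K : Type u} [Field K] [CharZero K] (t₀ : Set K)

/-- `ℤ[t₀] ⊆ ℚ(t₀)` inside `K`. [folklore] -/
private theorem mem_adjoin_rat_of_mem_adjoin_int {x : K} (hx : x ∈ Algebra.adjoin ℤ t₀) :
    x ∈ IntermediateField.adjoin ℚ t₀ := by
  induction hx using Algebra.adjoin_induction with
  | mem y hy => exact IntermediateField.subset_adjoin ℚ t₀ hy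
  | algebraMap z => rw [eq_intCast]; exact intCast_mem _ z
  | add y z _ _ hy hz => exact add_mem hy hz
  | mul y z _ _ hy hz => exact mul_mem hy hz

/-- Every element of `ℚ[t₀]` has a non-zero integer multiple in `ℤ[t₀]`. [folklore] -/
private theorem exists_int_mul_mem_adjoin {x : K} (hx : x ∈ Algebra.adjoin ℚ t₀) :
    ∃ m : ℤ, m ≠ 0 ∧ (m : K) * x ∈ Algebra.adjoin ℤ t₀ := by
  induction hx using Algebra.adjoin_induction with
  | mem y hy => exact ⟨1, one_ne_zero, by simpa using Algebra.subset_adjoin hy⟩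
  | algebraMap q =>
    refine ⟨q.den, by exact_mod_cast q.den_ne_zero, ?_⟩
    have h : ((q.den : ℤ) : K) * algebraMap ℚ K q = ((q.num : ℤ) : K) := by
      rw [eq_ratCast, Int.cast_natCast, ← Rat.cast_natCast, ← Rat.cast_intCast, ← Rat.cast_mul,
        Rat.den_mul_eq_num]
    rw [h]
    exact Subalgebra.intCast_mem _ q.num
  | add y z _ _ hy hz =>
    obtain ⟨m, hm, hmy⟩ := hy
    obtain ⟨m', hm', hmz⟩ := hz
    refine ⟨m * m', mul_ne_zero hm hm', ?_⟩
    have h : ((m * m' : ℤ) : K) * (y + z) = (m' : K) * ((m : K) * y) + (m : K) * ((m' : K) * z) := by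
      push_cast; ring
    rw [h]
    exact add_mem (Subalgebra.mul_mem _ (Subalgebra.intCast_mem _ m') hmy)
      (Subalgebra.mul_mem _ (Subalgebra.intCast_mem _ m) hmz)
  | mul y z _ _ hy hz =>
    obtain ⟨m, hm, hmy⟩ := hy
    obtain ⟨m', hm', hmz⟩ := hz
    refine ⟨m * m', mul_ne_zero hm hm', ?_⟩
    have h : ((m * m' : ℤ) : K) * (y * z) = ((m : K) * y) * ((m' : K) * z) := by push_cast; ring
    rw [h]
    exact Subalgebra.mul_mem _ hmy hmz

/-- **`ℚ(t₀)` is the fraction field of `ℤ[t₀]`** (inside a field `K` of characteristic zero, for any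
set `t₀ ⊆ K`), for any algebra structure `ℤ[t₀] → ℚ(t₀)` compatible with the two inclusions into
`K`: every element of `ℚ(t₀)` is a quotient of elements of `ℚ[t₀]` (Mathlib
`IntermediateField.mem_adjoin_iff_div`), and clearing an integer denominator puts numerator and
denominator in `ℤ[t₀]`. [folklore] -/
private theorem isFractionRing_adjoin_int [Algebra (Algebra.adjoin ℤ t₀) (IntermediateField.adjoin ℚ t₀)]
    (halg : ∀ x : Algebra.adjoin ℤ t₀,
      ((algebraMap (Algebra.adjoin ℤ t₀) (IntermediateField.adjoin ℚ t₀) x :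
        IntermediateField.adjoin ℚ t₀) : K) = x) :
    IsFractionRing (Algebra.adjoin ℤ t₀) (IntermediateField.adjoin ℚ t₀) := by
  haveI : FaithfulSMul (Algebra.adjoin ℤ t₀) (IntermediateField.adjoin ℚ t₀) := by
    rw [faithfulSMul_iff_algebraMap_injective]
    intro x y hxy
    have h := congrArg (fun z : IntermediateField.adjoin ℚ t₀ => (z : K)) hxy
    simp only [halg] at h
    exact Subtype.ext h
  refine IsFractionRing.of_field _ _ fun z => ?_
  obtain ⟨r, hr, s, hs, hz⟩ := IntermediateField.mem_adjoin_iff_div.mp z.2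
  obtain ⟨m, hm, hmr⟩ := exists_int_mul_mem_adjoin t₀ hr
  obtain ⟨m', hm', hms⟩ := exists_int_mul_mem_adjoin t₀ hs
  refine ⟨⟨(m' : K) * ((m : K) * r), Subalgebra.mul_mem _ (Subalgebra.intCast_mem _ m') hmr⟩,
    ⟨(m : K) * ((m' : K) * s), Subalgebra.mul_mem _ (Subalgebra.intCast_mem _ m) hms⟩,
    Subtype.ext ?_⟩
  rw [IntermediateField.coe_div, halg, halg]
  change (z : K) = ((m' : K) * ((m : K) * r)) / ((m : K) * ((m' : K) * s))
  rw [hz]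
  by_cases hs0 : s = 0
  · simp [hs0]
  have hm0 : (m : K) ≠ 0 := by exact_mod_cast hm
  have hm0' : (m' : K) ≠ 0 := by exact_mod_cast hm'
  field_simp

end FractionField

/-! ## The model -/

/-- **Smooth projective varieties in characteristic zero have smooth projective models over a
finitely generated subring** (EGA IV₃ 8.8.2 (ii), 8.10.5 (xiii); IV₄ 17.7.8 (ii); the "spreading
out" step of reduction modulo `p`, e.g. Maulik–Poonen 2012, §4). For a smooth projective
geometrically irreducible variety `X` of dimension `n` over a field `K` of characteristic zero there
are an integral domain `T` of finite type over `ℤ` with an injective ring map `ψ : T → K`, a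
closed subscheme `Y ↪ ℙᴺ_T` whose structure map `g : Y → Spec T` is proper and smooth of relative
dimension `n`, and `π : X → Y` with `IsPullback π (X → Spec K) g (Spec ψ)`: `X` is the base change
of `Y` along `T ⊆ K`. Proof as in the module docstring (`ℚ(t₀) = Frac ℤ[t₀]`, projective
closure over `ℤ[t₀]`, generic smoothness spread). [cite: EGAIV4, Prop. 17.7.8 (ii)]
[cite: MaulikPoonen2012, §4] -/
theorem exists_smooth_projective_model_finiteType_int {K : Type} [Field K] [CharZero K] {n : ℕ}
    {X : SchemeOver K} (hX : IsSmoothProjective n X) :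
    ∃ (T : Type) (_ : CommRing T) (_ : IsDomain T) (_ : Algebra.FiniteType ℤ T) (ψ : T →+* K)
      (_ : Function.Injective ψ) (N : ℕ) (Y : Scheme.{0}) (g : Y ⟶ Spec (.of T)),
      letI := MvPolynomial.gradedAlgebra (σ := Fin (N + 1)) (R := T)
      ∃ (emb : Y ⟶ Proj (homogeneousSubmodule (Fin (N + 1)) T)) (_ : IsClosedImmersion emb)
        (π : X.left ⟶ Y),
        emb ≫ ProjBaseChangeRing.projToSpec (Fin (N + 1)) T = g ∧
        IsProper g ∧ SmoothOfRelativeDimension n g ∧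
        IsPullback π X.hom g (Spec.map (CommRingCat.ofHom ψ)) := by
  classical
  -- A. `X` is integral
  haveI := hX.smoothOfRelativeDimension
  haveI : Smooth X.hom := SmoothOfRelativeDimension.smooth n X.hom
  haveI : IsReduced X.left := isReduced_of_smoothOfRelativeDimension X.hom n
  haveI : GeometricallyIrreducible X.hom := hX.geometricallyIrreducible
  haveI : Subsingleton ↥(Spec (CommRingCat.of K)) :=
    inferInstanceAs (Subsingleton (PrimeSpectrum K))
  haveI : IrreducibleSpace X.left :=
    GeometricallyIrreducible.irreducibleSpace_of_subsingleton (f := X.hom)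
  haveI : IsIntegral X.left := isIntegral_of_irreducibleSpace_of_isReduced X.left
  -- B. descent of `X ↪ ℙᴺ_K` to a finitely generated subfield `K₀ = ℚ(t₀)`
  obtain ⟨t₀, N, X₀, hX₀, ι₀, hι₀, π₀, Hpb, -⟩ :=
    Limits.exists_isPullback_specMap_of_isProjectiveOver ℚ K X hX.isProjectiveOver isClosed_empty
  let E : SchemeOver (IntermediateField.adjoin ℚ (t₀ : Set K)) :=
    Over.mk (ι₀ ≫ (projectiveSpace N (IntermediateField.adjoin ℚ (t₀ : Set K))).hom)
  have hE : IsProjectiveOver E := ⟨N, Over.homMk ι₀ rfl, hι₀⟩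
  set iK : Spec (.of K) ⟶ Spec (.of (IntermediateField.adjoin ℚ (t₀ : Set K))) :=
    Spec.map (CommRingCat.ofHom (algebraMap (IntermediateField.adjoin ℚ (t₀ : Set K)) K)) with hiK
  have HpbE : IsPullback π₀ X.hom E.hom iK := Hpb
  -- C. `E → Spec K₀` is smooth
  haveI : IsIntegral E.left := hX₀
  haveI : Smooth E.hom :=
    MorphismProperty.of_isPullback_of_descendsAlong (P := @Smooth)
      (Q := @Surjective ⊓ @Flat ⊓ @QuasiCompact) HpbE.flip
      (Motives.ProperDescent.fpqc_specMap (IntermediateField.adjoin ℚ (t₀ : Set K)) K) ‹Smooth X.hom›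
  -- D. the ring `R = ℤ[t₀]` (with `Frac R = K₀`) and an irreducible projective model over it
  set R : Subalgebra ℤ K := Algebra.adjoin ℤ (t₀ : Set K) with hR
  let incl : R →+* IntermediateField.adjoin ℚ (t₀ : Set K) :=
    { toFun := fun x => ⟨(x : K), mem_adjoin_rat_of_mem_adjoin_int (t₀ : Set K) x.2⟩
      map_one' := Subtype.ext rfl
      map_mul' := fun _ _ => Subtype.ext rfl
      map_zero' := Subtype.ext rfl
      map_add' := fun _ _ => Subtype.ext rfl }
  letI : Algebra R (IntermediateField.adjoin ℚ (t₀ : Set K)) := incl.toAlgebra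
  haveI : IsFractionRing R (IntermediateField.adjoin ℚ (t₀ : Set K)) :=
    isFractionRing_adjoin_int (t₀ : Set K) fun _ => rfl
  haveI : IsScalarTower R (IntermediateField.adjoin ℚ (t₀ : Set K)) K :=
    IsScalarTower.of_algebraMap_eq fun r => rfl
  haveI : Algebra.FiniteType ℤ R :=
    (Subalgebra.fg_iff_finiteType _).mp (Subalgebra.fg_adjoin_finset t₀)
  haveI : IsNoetherianRing R := Algebra.FiniteType.isNoetherianRing ℤ R
  obtain ⟨N', P, emb, hemb, gen, hPirr, HM⟩ :=
    exists_irreducible_projectiveModel R (IntermediateField.adjoin ℚ (t₀ : Set K)) E hE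
  letI := MvPolynomial.gradedAlgebra (σ := Fin (N' + 1)) (R := (R : Type))
  haveI : IsProper (ProjBaseChangeRing.projToSpec (Fin (N' + 1)) R) :=
    ProjBaseChangeRing.isProper_projToSpec _ R
  obtain ⟨f, hf⟩ : ∃ f : P ⟶ Spec (.of R), f = emb ≫ ProjBaseChangeRing.projToSpec (Fin (N' + 1)) R :=
    ⟨_, rfl⟩
  rw [← hf] at HM
  haveI : IsProper f := by rw [hf]; infer_instance
  haveI : LocallyOfFiniteType f := ‹IsProper f›.toLocallyOfFiniteType
  haveI : QuasiCompact f := inferInstance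
  set jR : Spec (.of (IntermediateField.adjoin ℚ (t₀ : Set K))) ⟶ Spec (.of R) :=
    Spec.map (CommRingCat.ofHom (algebraMap R (IntermediateField.adjoin ℚ (t₀ : Set K)))) with hjR
  -- E. shrinking `Spec R`: the model is smooth over a dense open
  have hgenSm : Smooth (pullback.snd f jR) := by
    rw [← HM.isoPullback_inv_snd]; infer_instance
  haveI : IsNoetherianRing (CommRingCat.of R) := ‹IsNoetherianRing R›
  haveI : IsLocallyNoetherian (Spec (CommRingCat.of R)) :=
    (isLocallyNoetherian_Spec (R := CommRingCat.of R)).mpr ‹_›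
  haveI : LocallyOfFinitePresentation (Over.mk f : SchemeOver R).hom :=
    LocallyOfFinitePresentation.iff_locallyOfFiniteType.mpr ‹LocallyOfFiniteType f›
  haveI : QuasiCompact (Over.mk f : SchemeOver R).hom := ‹QuasiCompact f›
  obtain ⟨s₁, hs₁, H₁⟩ := Limits.LocApprox.exists_forall_smooth_snd (nonZeroDivisors R)
    (IntermediateField.adjoin ℚ (t₀ : Set K)) (Over.mk f) hgenSm
  have hs₁0 : s₁ ≠ 0 := nonZeroDivisors.ne_zero hs₁
  let T : Type := Localization.Away s₁
  haveI : IsDomain T := IsLocalization.isDomain_localization (M := Submonoid.powers s₁)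
    (powers_le_nonZeroDivisors_of_noZeroDivisors hs₁0)
  haveI : Algebra.FinitePresentation R T := IsLocalization.Away.finitePresentation s₁
  have hft : Algebra.FiniteType ℤ T :=
    Algebra.FiniteType.trans (inferInstance : Algebra.FiniteType ℤ R) inferInstance
  -- the maps `T → K₀ → K`
  have hunit : IsUnit (algebraMap R (IntermediateField.adjoin ℚ (t₀ : Set K)) s₁) :=
    Ne.isUnit ((IsFractionRing.to_map_eq_zero_iff
      (K := (IntermediateField.adjoin ℚ (t₀ : Set K)))).not.mpr hs₁0)
  let φ₀ : T →+* (IntermediateField.adjoin ℚ (t₀ : Set K)) := IsLocalization.Away.lift s₁ hunit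
  letI : Algebra T (IntermediateField.adjoin ℚ (t₀ : Set K)) := φ₀.toAlgebra
  haveI : IsScalarTower R T (IntermediateField.adjoin ℚ (t₀ : Set K)) :=
    IsScalarTower.of_algebraMap_eq fun r ↦ (IsLocalization.Away.lift_eq s₁ hunit r).symm
  haveI : IsFractionRing T (IntermediateField.adjoin ℚ (t₀ : Set K)) :=
    IsFractionRing.isFractionRing_of_isDomain_of_isLocalization (Submonoid.powers s₁) T _
  let ψ : T →+* K := (algebraMap (IntermediateField.adjoin ℚ (t₀ : Set K)) K).comp φ₀
  have hψinj : Function.Injective ψ :=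
    (algebraMap (IntermediateField.adjoin ℚ (t₀ : Set K)) K).injective.comp
      (IsFractionRing.injective T (IntermediateField.adjoin ℚ (t₀ : Set K)))
  -- the family `g : Y = P ×_R Spec T → Spec T`
  set jT : Spec (.of T) ⟶ Spec (.of R) := Spec.map (CommRingCat.ofHom (algebraMap R T)) with hjT
  haveI : IsOpenImmersion jT := IsOpenImmersion.of_isLocalization s₁
  set jKT : Spec (.of (IntermediateField.adjoin ℚ (t₀ : Set K))) ⟶ Spec (.of T) :=
    Spec.map (CommRingCat.ofHom (algebraMap T (IntermediateField.adjoin ℚ (t₀ : Set K)))) with hjKT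
  have hjfac : jR = jKT ≫ jT := by
    rw [hjR, hjKT, hjT, ← Spec.map_comp, ← CommRingCat.ofHom_comp, ← IsScalarTower.algebraMap_eq]
  have hψfac : iK ≫ jKT = Spec.map (CommRingCat.ofHom ψ) := by
    rw [hiK, hjKT, ← Spec.map_comp, ← CommRingCat.ofHom_comp]
  have sqY : IsPullback (pullback.fst f jT) (pullback.snd f jT) f jT := IsPullback.of_hasPullback f jT
  have hgSm : Smooth (pullback.snd f jT) := H₁ s₁ dvd_rfl T
  letI := MvPolynomial.gradedAlgebra (σ := Fin (N' + 1)) (R := T)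
  obtain ⟨embT, hembT, hembTg⟩ : ∃ embT : pullback f jT ⟶ Proj (homogeneousSubmodule (Fin (N' + 1)) T),
      IsClosedImmersion embT ∧
        embT ≫ ProjBaseChangeRing.projToSpec (Fin (N' + 1)) T = pullback.snd f jT := by
    have h := exists_isClosedImmersion_pullback_proj T emb
    rw [← hf] at h
    exact h
  -- `E = Y ×_T Spec K₀`
  have HM' : IsPullback gen E.hom f (jKT ≫ jT) := hjfac ▸ HM
  let ℓE : E.left ⟶ pullback f jT :=
    sqY.lift gen (E.hom ≫ jKT) (by rw [Category.assoc]; exact HM'.w)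
  have hℓ₁ : ℓE ≫ pullback.fst f jT = gen := sqY.lift_fst _ _ _
  have hℓ₂ : ℓE ≫ pullback.snd f jT = E.hom ≫ jKT := sqY.lift_snd _ _ _
  have SqE : IsPullback ℓE E.hom (pullback.snd f jT) jKT :=
    IsPullback.of_right (by rw [hℓ₁]; exact HM') hℓ₂ sqY
  -- `Y` is irreducible, hence smooth of one relative dimension, which is `n` (compare on `X`)
  haveI : Nonempty ↥(pullback f jT) := ⟨ℓE.base (Classical.arbitrary E.left)⟩
  haveI : IrreducibleSpace ↥(pullback f jT) := (pullback.fst f jT).isOpenEmbedding.irreducibleSpace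
  haveI : Smooth (pullback.snd f jT) := hgSm
  obtain ⟨d, hd⟩ := exists_smoothOfRelativeDimension_of_smooth (pullback.snd f jT)
  have HX : IsPullback (π₀ ≫ ℓE) X.hom (pullback.snd f jT) (Spec.map (CommRingCat.ofHom ψ)) := by
    rw [← hψfac]; exact HpbE.paste_horiz SqE
  haveI := smoothOfRelativeDimension_isStableUnderBaseChange (n := d)
  have hdX' : SmoothOfRelativeDimension d X.hom := MorphismProperty.of_isPullback HX hd
  obtain rfl : n = d :=
    (AbelianVarietyProofs.eq_of_smoothOfRelativeDimension X.hom hdX' hX.smoothOfRelativeDimension).symm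
  haveI : IsProper (pullback.snd f jT) := inferInstance
  have hft' : @Algebra.FiniteType ℤ T _ _ (Ring.toIntAlgebra T) := by
    have h : (Ring.toIntAlgebra T : Algebra ℤ T) = OreLocalization.instAlgebra :=
      Subsingleton.elim _ _
    rw [h]; exact hft
  exact ⟨T, inferInstance, inferInstance, hft', ψ, hψinj, N', pullback f jT,
    pullback.snd f jT, embT, hembT, π₀ ≫ ℓE, hembTg, inferInstance, hd, HX⟩

end Literature.AlgebraicGeometry.Limits

end
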